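import Mathlib
import Literature.AlgebraicGeometry.Resolution.Lipman1969RationalContraction
import HarnessLib

/-!
# Crux `NoZenoR` (stmt-ResolutionOfSingularities-19943), slot 5 `stub_L1wCoreF`, (B1) UP-5 — scheme side, part 1/3:
# global sections of a closed subscheme covered by two affine opens; `h⁰` of a subscheme inside an affine open

OURS (cell res-hironaka, crux chain W4.4, seat res-L0-w44-stub-1 g11; object UP-5a/b of the (B1) split core of
slot 5 `stub_L1wCoreF`, res-L0-w44-stub-2 L1W-PREP §3.3 / lead B1-CENSUS-g8). Nothing here is a statement of the
manuscript under review (Hironaka 2017); AI-written, weaker than expert review. Def-free, fact-free.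

This file is the sheaf-theoretic half of the `h⁰`-numerics of a point blow-up (Lipman 1969 §10/§13: `h0 π 𝓘 =
ℓ_S Γ(X, 𝒪_X/𝓘)`, the tree's `Literature.AlgebraicGeometry.Resolution.h0`), generic in the scheme:

* `exists_ringEquiv_sections_subscheme` — `Γ(V(K), ι⁻¹U) ≅ Γ(Y, U)/K(U)` for `U` affine (Mathlib
  `IdealSheafData.subschemeι_app_surjective` / `ker_subschemeι_app`);
* `exists_sections_subscheme_embedding` — **if `supp K ⊆ U₁ ∪ U₂` with `U₁, U₂, U₁ ∩ U₂` affine, then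
  `Γ(V(K), 𝒪) ↪ Γ(Y, U₁)/K(U₁) × Γ(Y, U₂)/K(U₂)` with image the pairs agreeing in `Γ(Y, U₁ ∩ U₂)/K(U₁ ∩ U₂)`**,
  sections of `Y` over `O ⊇ U₁ ∪ U₂` going to `(s|U₁, s|U₂)` (the sheaf property of `𝒪_{V(K)}`, Mathlib
  `TopCat.Sheaf.objSupIsoProdEqLocus` / `eq_of_locally_eq₂`);
* `length_eq_of_ringEquiv`, `length_eq_of_injective_of_range_eq` — transport of `S`-lengths along ring maps
  compatible with the structure maps from `S`;
* `algebraMap_sections_eq`, `algebraMap_sections_eq₂` — the structure map `S → Γ(V, 𝒪_V)` of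
  `Sections (ι ≫ ρ ≫ π) ⊤` factors through `Γ(X, W)` when `V` maps into `W`;
* `h0_eq_length_quotient` — **`h0 π J = ℓ_S (Γ(X, W)/J(W))` for `J` supported in the affine open `W`**
  (e.g. the reduced closed point `x`: `h0 = [κ(x) : κ_S]`).

References: J. Lipman, Publ. Math. IHÉS 36 (1969), §10 p. 212, §13 p. 223 [`Lipman1969`]; The Stacks Project,
Tags 01HQ (closed subschemes and ideal sheaves), 009U (sheaf condition on two opens) [`StacksProject`].
-/

noncomputable section

-- single-problem summit: the doubled namespace component `ResolutionOfSingularities` is forced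
set_option linter.dupNamespace false

namespace Summit.ResolutionOfSingularities.ResolutionOfSingularities.Theorems.NoZeno.ExcCount.PointBlowup

open CategoryTheory AlgebraicGeometry TopologicalSpace Opposite
open Literature.AlgebraicGeometry.Resolution Literature.AlgebraicGeometry.Morphisms

universe u

/-! ## §5 Sections of a closed subscheme covered by two affine opens -/

section Glue

variable {Y : Scheme.{u}} (K : Y.IdealSheafData)

/-- For an affine open `U`, the map `Γ(Y, U) → Γ(V(K), ι⁻¹U)` is onto with kernel `K(U)`; packaged
as a ring isomorphism `θ : Γ(V(K), ι⁻¹U) ≃ Γ(Y, U)/K(U)` with `θ (ι^* a) = ā`. [folklore] -/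
theorem exists_ringEquiv_sections_subscheme (U : Y.affineOpens) :
    ∃ θ : Γ(K.subscheme, K.subschemeι ⁻¹ᵁ (U : Y.Opens)) ≃+* (Γ(Y, U) ⧸ K.ideal U),
      ∀ a, θ (K.subschemeι.app U a) = Ideal.Quotient.mk _ a := by
  have hs := K.subschemeι_app_surjective U
  have hk := K.ker_subschemeι_app U
  refine ⟨(RingHom.quotientKerEquivOfSurjective hs).symm.trans (Ideal.quotEquivOfEq hk), fun a => ?_⟩
  rw [RingEquiv.trans_apply]
  have : (RingHom.quotientKerEquivOfSurjective hs).symm (K.subschemeι.app U a) =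
      Ideal.Quotient.mk _ a := RingHom.quotientKerEquivOfSurjective_symm_apply hs a
  rw [this, Ideal.quotEquivOfEq_mk]

/-- **Global sections of a closed subscheme covered by two affine opens.** Let `K` be an ideal
sheaf on `Y` whose support lies in `U₁ ∪ U₂` for affine opens `U₁, U₂` with affine intersection.
Then restriction to `U₁`, `U₂` embeds `Γ(V(K), 𝒪)` into `Γ(Y, U₁)/K(U₁) × Γ(Y, U₂)/K(U₂)`, with image
the pairs `(ā, b̄)` that agree in `Γ(Y, U₁ ∩ U₂)/K(U₁ ∩ U₂)` (the sheaf property of `𝒪_{V(K)}` on the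
cover `ι⁻¹U₁ ∪ ι⁻¹U₂` together with `Γ(V(K), ι⁻¹U) = Γ(Y, U)/K(U)` for affine `U`), and a section of
`Y` over an open `O ⊇ U₁ ∪ U₂` goes to `(s|U₁, s|U₂)`. [folklore] -/
theorem exists_sections_subscheme_embedding (U₁ U₂ : Y.affineOpens)
    (h₁₂ : IsAffineOpen ((U₁ : Y.Opens) ⊓ U₂))
    (hK : (K.support : Set Y) ⊆ ((U₁ : Y.Opens) ⊔ U₂ : Y.Opens)) :
    ∃ Ψ : Γ(K.subscheme, ⊤) →+* (Γ(Y, U₁) ⧸ K.ideal U₁) × (Γ(Y, U₂) ⧸ K.ideal U₂),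
      Function.Injective Ψ ∧
      (∀ (a : Γ(Y, U₁)) (b : Γ(Y, U₂)),
        (Ideal.Quotient.mk _ a, Ideal.Quotient.mk _ b) ∈ Set.range Ψ ↔
          Y.presheaf.map (homOfLE inf_le_left).op a - Y.presheaf.map (homOfLE inf_le_right).op b ∈
            K.ideal ⟨(U₁ : Y.Opens) ⊓ U₂, h₁₂⟩) ∧
      (∀ (O : Y.Opens) (hO : (⊤ : K.subscheme.Opens) ≤ K.subschemeι ⁻¹ᵁ O)
        (hO₁ : (U₁ : Y.Opens) ≤ O) (hO₂ : (U₂ : Y.Opens) ≤ O) (s : Γ(Y, O)),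
        Ψ (K.subschemeι.appLE O ⊤ hO s) =
          (Ideal.Quotient.mk _ (Y.presheaf.map (homOfLE hO₁).op s),
            Ideal.Quotient.mk _ (Y.presheaf.map (homOfLE hO₂).op s))) := by
  set V := K.subscheme with hVdef
  set ι := K.subschemeι with hιdef
  obtain ⟨θ₁, hθ₁⟩ := exists_ringEquiv_sections_subscheme K U₁
  obtain ⟨θ₂, hθ₂⟩ := exists_ringEquiv_sections_subscheme K U₂
  -- the two opens `Vᵢ = ι⁻¹Uᵢ` cover `V(K)`
  have hcov : (⊤ : V.Opens) ≤ ι ⁻¹ᵁ (U₁ : Y.Opens) ⊔ ι ⁻¹ᵁ (U₂ : Y.Opens) := by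
    intro p _
    have hp : ι.base p ∈ (K.support : Set Y) := by
      rw [← Scheme.IdealSheafData.range_subschemeι]; exact ⟨p, rfl⟩
    exact hK hp
  let res₁ : Γ(V, ⊤) →+* Γ(V, ι ⁻¹ᵁ (U₁ : Y.Opens)) := (V.presheaf.map (homOfLE le_top).op).hom
  let res₂ : Γ(V, ⊤) →+* Γ(V, ι ⁻¹ᵁ (U₂ : Y.Opens)) := (V.presheaf.map (homOfLE le_top).op).hom
  let Ψ : Γ(V, ⊤) →+* (Γ(Y, U₁) ⧸ K.ideal U₁) × (Γ(Y, U₂) ⧸ K.ideal U₂) :=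
    RingHom.prod (θ₁.toRingHom.comp res₁) (θ₂.toRingHom.comp res₂)
  have hΨ : ∀ s, Ψ s = (θ₁ (res₁ s), θ₂ (res₂ s)) := fun s => rfl
  -- naturality of `ι^*` with restriction to the overlap
  have hnat₁ : ∀ a : Γ(Y, U₁), V.presheaf.map (homOfLE (inf_le_left :
      ι ⁻¹ᵁ (U₁ : Y.Opens) ⊓ ι ⁻¹ᵁ (U₂ : Y.Opens) ≤ _)).op (ι.app U₁ a) =
      ι.app ((U₁ : Y.Opens) ⊓ U₂) (Y.presheaf.map (homOfLE inf_le_left).op a) := fun a =>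
    (CategoryTheory.congr_fun
      (ι.naturality (homOfLE (inf_le_left : (U₁ : Y.Opens) ⊓ U₂ ≤ U₁)).op) a).symm
  have hnat₂ : ∀ b : Γ(Y, U₂), V.presheaf.map (homOfLE (inf_le_right :
      ι ⁻¹ᵁ (U₁ : Y.Opens) ⊓ ι ⁻¹ᵁ (U₂ : Y.Opens) ≤ _)).op (ι.app U₂ b) =
      ι.app ((U₁ : Y.Opens) ⊓ U₂) (Y.presheaf.map (homOfLE inf_le_right).op b) := fun b =>
    (CategoryTheory.congr_fun
      (ι.naturality (homOfLE (inf_le_right : (U₁ : Y.Opens) ⊓ U₂ ≤ U₂)).op) b).symm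
  -- the kernel on the overlap
  have hker₁₂ : ∀ c d : Γ(Y, (U₁ : Y.Opens) ⊓ U₂),
      ι.app ((U₁ : Y.Opens) ⊓ U₂) c = ι.app ((U₁ : Y.Opens) ⊓ U₂) d ↔
        c - d ∈ K.ideal ⟨(U₁ : Y.Opens) ⊓ U₂, h₁₂⟩ := fun c d => by
    rw [← K.ker_subschemeι_app ⟨(U₁ : Y.Opens) ⊓ U₂, h₁₂⟩, ← RingHom.sub_mem_ker_iff]
  -- `θᵢ t = ā ↔ t = ι^* a`
  have hθ₁' : ∀ t a, θ₁ t = Ideal.Quotient.mk _ a ↔ t = ι.app U₁ a := fun t a => by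
    rw [← hθ₁ a]; exact θ₁.injective.eq_iff
  have hθ₂' : ∀ t b, θ₂ t = Ideal.Quotient.mk _ b ↔ t = ι.app U₂ b := fun t b => by
    rw [← hθ₂ b]; exact θ₂.injective.eq_iff
  refine ⟨Ψ, ?_, ?_, ?_⟩
  · -- injectivity: the sheaf property on the cover `ι⁻¹U₁ ∪ ι⁻¹U₂`
    intro s t hst
    rw [hΨ, hΨ, Prod.mk.injEq] at hst
    exact TopCat.Sheaf.eq_of_locally_eq₂ V.sheaf (homOfLE le_top) (homOfLE le_top) hcov s t
      (θ₁.injective hst.1) (θ₂.injective hst.2)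
  · intro a b
    constructor
    · rintro ⟨s, hs⟩
      rw [hΨ, Prod.mk.injEq, hθ₁', hθ₂'] at hs
      -- restrict both to the overlap
      have h1 := congr_arg (V.presheaf.map (homOfLE (inf_le_left :
        ι ⁻¹ᵁ (U₁ : Y.Opens) ⊓ ι ⁻¹ᵁ (U₂ : Y.Opens) ≤ _)).op) hs.1
      have h2 := congr_arg (V.presheaf.map (homOfLE (inf_le_right :
        ι ⁻¹ᵁ (U₁ : Y.Opens) ⊓ ι ⁻¹ᵁ (U₂ : Y.Opens) ≤ _)).op) hs.2
      rw [hnat₁] at h1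
      rw [hnat₂] at h2
      have e1 : V.presheaf.map (homOfLE (inf_le_left :
          ι ⁻¹ᵁ (U₁ : Y.Opens) ⊓ ι ⁻¹ᵁ (U₂ : Y.Opens) ≤ _)).op (res₁ s) =
          V.presheaf.map (homOfLE (inf_le_right :
          ι ⁻¹ᵁ (U₁ : Y.Opens) ⊓ ι ⁻¹ᵁ (U₂ : Y.Opens) ≤ _)).op (res₂ s) := by
        change (V.presheaf.map _ ≫ V.presheaf.map _) s = (V.presheaf.map _ ≫ V.presheaf.map _) s
        rw [← Functor.map_comp, ← Functor.map_comp]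
        rfl
      rw [h1, h2] at e1
      exact (hker₁₂ _ _).mp e1
    · intro hab
      -- glue `ι^* a` and `ι^* b`
      have hab' : ι.app ((U₁ : Y.Opens) ⊓ U₂) (Y.presheaf.map (homOfLE inf_le_left).op a) =
          ι.app ((U₁ : Y.Opens) ⊓ U₂) (Y.presheaf.map (homOfLE inf_le_right).op b) :=
        (hker₁₂ _ _).mpr hab
      have hcompat : V.presheaf.map (homOfLE (inf_le_left :
          ι ⁻¹ᵁ (U₁ : Y.Opens) ⊓ ι ⁻¹ᵁ (U₂ : Y.Opens) ≤ _)).op (ι.app U₁ a) =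
          V.presheaf.map (homOfLE (inf_le_right :
          ι ⁻¹ᵁ (U₁ : Y.Opens) ⊓ ι ⁻¹ᵁ (U₂ : Y.Opens) ≤ _)).op (ι.app U₂ b) := by
        rw [hnat₁, hnat₂, hab']
      let G := V.sheaf.objSupIsoProdEqLocus (ι ⁻¹ᵁ (U₁ : Y.Opens)) (ι ⁻¹ᵁ (U₂ : Y.Opens))
      let s₀ : Γ(V, ι ⁻¹ᵁ (U₁ : Y.Opens) ⊔ ι ⁻¹ᵁ (U₂ : Y.Opens)) :=
        G.inv ⟨(ι.app U₁ a, ι.app U₂ b), hcompat⟩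
      have hs₀₁ : V.presheaf.map (homOfLE le_sup_left).op s₀ = ι.app U₁ a :=
        TopCat.Sheaf.objSupIsoProdEqLocus_inv_fst V.sheaf _ _ _
      have hs₀₂ : V.presheaf.map (homOfLE le_sup_right).op s₀ = ι.app U₂ b :=
        TopCat.Sheaf.objSupIsoProdEqLocus_inv_snd V.sheaf _ _ _
      refine ⟨V.presheaf.map (homOfLE hcov).op s₀, ?_⟩
      rw [hΨ, Prod.mk.injEq, hθ₁', hθ₂']
      constructor
      · change (V.presheaf.map _ ≫ V.presheaf.map _) s₀ = _
        rw [← Functor.map_comp]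
        exact hs₀₁
      · change (V.presheaf.map _ ≫ V.presheaf.map _) s₀ = _
        rw [← Functor.map_comp]
        exact hs₀₂
  · intro O hO hO₁ hO₂ s
    rw [hΨ, Prod.mk.injEq, hθ₁', hθ₂']
    constructor
    · change (ι.appLE O ⊤ hO ≫ V.presheaf.map (homOfLE le_top).op) s = _
      rw [Scheme.Hom.appLE_map, Scheme.Hom.app_eq_appLE]
      change _ = (Y.presheaf.map (homOfLE hO₁).op ≫ ι.appLE (U₁ : Y.Opens) _ le_rfl) s
      rw [Scheme.Hom.map_appLE]
    · change (ι.appLE O ⊤ hO ≫ V.presheaf.map (homOfLE le_top).op) s = _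
      rw [Scheme.Hom.appLE_map, Scheme.Hom.app_eq_appLE]
      change _ = (Y.presheaf.map (homOfLE hO₂).op ≫ ι.appLE (U₂ : Y.Opens) _ le_rfl) s
      rw [Scheme.Hom.map_appLE]

end Glue

/-! ## §6 Transport of `S`-lengths along structure-compatible ring maps -/

section Transport

variable {S : Type*} [CommRing S]

/-- A ring isomorphism compatible with the structure maps from `S` preserves `S`-lengths. [folklore] -/
theorem length_eq_of_ringEquiv {R₁ R₂ : Type*} [CommRing R₁] [CommRing R₂] [Algebra S R₁]
    [Algebra S R₂] (e : R₁ ≃+* R₂) (he : ∀ s, e (algebraMap S R₁ s) = algebraMap S R₂ s) :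
    Module.length S R₁ = Module.length S R₂ :=
  (AlgEquiv.ofRingEquiv (f := e) he).toLinearEquiv.length_eq

/-- An injective ring map compatible with the structure maps from `S`, with range an
`A`-submodule `E` (for an intermediate `S → A`), identifies `S`-lengths. [folklore] -/
theorem length_eq_of_injective_of_range_eq {R M A : Type*} [CommRing R] [CommRing M] [CommRing A]
    [Algebra S R] [Algebra S M] [Algebra S A] [Algebra A M] [IsScalarTower S A M]
    (Ψ : R →+* M) (hΨ : Function.Injective Ψ) (hS : ∀ s, Ψ (algebraMap S R s) = algebraMap S M s)
    (E : Submodule A M) (hE : ∀ m, m ∈ E ↔ m ∈ Set.range Ψ) :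
    Module.length S R = Module.length S E := by
  let Ψ' : R →ₗ[S] M :=
    { toFun := Ψ
      map_add' := fun a b => map_add Ψ a b
      map_smul' := fun s a => by
        rw [Algebra.smul_def, map_mul, hS, RingHom.id_apply, Algebra.smul_def] }
  have hΨ' : Function.Injective Ψ' := hΨ
  have hrange : LinearMap.range Ψ' = E.restrictScalars S := by
    ext m
    rw [LinearMap.mem_range, Submodule.restrictScalars_mem, hE, Set.mem_range]
    rfl
  rw [(LinearEquiv.ofInjective Ψ' hΨ').length_eq, (LinearEquiv.ofEq _ _ hrange).length_eq]
  rfl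

end Transport

/-! ## §6b The structure map of `Γ(V, 𝒪_V)` for `V → X' → X → Spec S` factors through `Γ(X, W)` -/

section Compat

variable {S : Type u} [CommRing S] {X X' V : Scheme.{u}} (π : X ⟶ Spec (.of S)) (ρ : X' ⟶ X)
  (ι : V ⟶ X') (W : X.Opens) (hO : (⊤ : V.Opens) ≤ ι ⁻¹ᵁ (ρ ⁻¹ᵁ W))

/-- `S → Γ(V, 𝒪_V)` is `S → Γ(X, ⊤) → Γ(X, W) → Γ(X', ρ⁻¹W) → Γ(V, ⊤)`. [folklore] -/
theorem algebraMap_sections_eq (s : S) :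
    algebraMap S (Sections (ι ≫ ρ ≫ π) ⊤) s =
      ι.appLE (ρ ⁻¹ᵁ W) ⊤ hO (ρ.app W (X.presheaf.map (homOfLE (le_top : W ≤ ⊤)).op
        (algebraMapΓ π s))) := by
  have key : (ι ≫ ρ ≫ π).appTop ≫ V.presheaf.map (homOfLE (le_top : (⊤ : V.Opens) ≤ ⊤)).op =
      π.appTop ≫ X.presheaf.map (homOfLE (le_top : W ≤ ⊤)).op ≫ ρ.app W ≫
        ι.appLE (ρ ⁻¹ᵁ W) ⊤ hO := by
    have h1 : (ι ≫ ρ ≫ π).appTop ≫ V.presheaf.map (homOfLE (le_top : (⊤ : V.Opens) ≤ ⊤)).op =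
        (ι ≫ ρ ≫ π).appLE ⊤ ⊤ le_top := rfl
    have h2 : π.appTop ≫ X.presheaf.map (homOfLE (le_top : W ≤ ⊤)).op = π.appLE ⊤ W le_top := rfl
    have h3 : ρ.app W ≫ ι.appLE (ρ ⁻¹ᵁ W) ⊤ hO = (ι ≫ ρ).appLE W ⊤ hO := by
      rw [Scheme.Hom.app_eq_appLE, Scheme.Hom.appLE_comp_appLE]
    rw [h1, reassoc_of% h2, h3, Scheme.Hom.appLE_comp_appLE]
    rfl
  rw [Sections.algebraMap_apply]
  change ((ι ≫ ρ ≫ π).appTop ≫ V.presheaf.map (homOfLE (le_top : (⊤ : V.Opens) ≤ ⊤)).op)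
      ((Scheme.ΓSpecIso (.of S)).inv s) =
    (π.appTop ≫ X.presheaf.map (homOfLE (le_top : W ≤ ⊤)).op ≫ ρ.app W ≫ ι.appLE (ρ ⁻¹ᵁ W) ⊤ hO)
      ((Scheme.ΓSpecIso (.of S)).inv s)
  rw [key]

/-- `S → Γ(V, 𝒪_V)` for `V → X → Spec S` is `S → Γ(X, ⊤) → Γ(X, W) → Γ(V, ⊤)` when `V` maps into `W`.
[folklore] -/
theorem algebraMap_sections_eq₂ {V : Scheme.{u}} (ι : V ⟶ X) (hO : (⊤ : V.Opens) ≤ ι ⁻¹ᵁ W)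
    (s : S) :
    algebraMap S (Sections (ι ≫ π) ⊤) s =
      ι.appLE W ⊤ hO (X.presheaf.map (homOfLE (le_top : W ≤ ⊤)).op (algebraMapΓ π s)) := by
  have key : (ι ≫ π).appTop ≫ V.presheaf.map (homOfLE (le_top : (⊤ : V.Opens) ≤ ⊤)).op =
      π.appTop ≫ X.presheaf.map (homOfLE (le_top : W ≤ ⊤)).op ≫ ι.appLE W ⊤ hO := by
    have h1 : (ι ≫ π).appTop ≫ V.presheaf.map (homOfLE (le_top : (⊤ : V.Opens) ≤ ⊤)).op =
        (ι ≫ π).appLE ⊤ ⊤ le_top := rfl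
    have h2 : π.appTop ≫ X.presheaf.map (homOfLE (le_top : W ≤ ⊤)).op = π.appLE ⊤ W le_top := rfl
    rw [h1, reassoc_of% h2, Scheme.Hom.appLE_comp_appLE]
  rw [Sections.algebraMap_apply]
  change ((ι ≫ π).appTop ≫ V.presheaf.map (homOfLE (le_top : (⊤ : V.Opens) ≤ ⊤)).op)
      ((Scheme.ΓSpecIso (.of S)).inv s) =
    (π.appTop ≫ X.presheaf.map (homOfLE (le_top : W ≤ ⊤)).op ≫ ι.appLE W ⊤ hO)
      ((Scheme.ΓSpecIso (.of S)).inv s)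
  rw [key]

end Compat

/-! ## §6c `h⁰` of an ideal sheaf supported in an affine open -/

section Centre

variable {S : Type u} [CommRing S] {X : Scheme.{u}} (π : X ⟶ Spec (.of S)) (J : X.IdealSheafData)
  (W : X.affineOpens) (hJW : (J.support : Set X) ⊆ (W : X.Opens))

include hJW in
/-- **`h⁰(𝒪_X/J) = ℓ_S(Γ(X, W)/J(W))`** for an ideal sheaf `J` supported in an affine open `W`
(`Γ(V(J), 𝒪) = Γ(X, W)/J(W)`), `Γ(X, W)` being an `S`-algebra through `π`. [folklore] -/
theorem h0_eq_length_quotient :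
    letI : Algebra S Γ(X, W) :=
      ((X.presheaf.map (homOfLE (le_top : (W : X.Opens) ≤ ⊤)).op).hom.comp (algebraMapΓ π)).toAlgebra
    h0 π J = Module.length S (Γ(X, W) ⧸ J.ideal W) := by
  letI instSA : Algebra S Γ(X, W) :=
    ((X.presheaf.map (homOfLE (le_top : (W : X.Opens) ≤ ⊤)).op).hom.comp (algebraMapΓ π)).toAlgebra
  obtain ⟨θ, hθ⟩ := exists_ringEquiv_sections_subscheme J W
  have hO : (⊤ : J.subscheme.Opens) ≤ J.subschemeι ⁻¹ᵁ (W : X.Opens) := by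
    intro p _
    have hp : J.subschemeι.base p ∈ (J.support : Set X) := by
      rw [← Scheme.IdealSheafData.range_subschemeι]; exact ⟨p, rfl⟩
    exact hJW hp
  have htop : J.subschemeι ⁻¹ᵁ (W : X.Opens) = ⊤ := top_le_iff.mp hO
  let e0 : Γ(J.subscheme, ⊤) ≃+* Γ(J.subscheme, J.subschemeι ⁻¹ᵁ (W : X.Opens)) :=
    (J.subscheme.presheaf.mapIso (eqToIso htop).op).commRingCatIsoToRingEquiv
  have he0 : ∀ y : Γ(X, W), e0 (J.subschemeι.appLE W ⊤ hO y) = J.subschemeι.app W y := by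
    intro y
    change (J.subschemeι.appLE W ⊤ hO ≫ J.subscheme.presheaf.map (eqToHom htop).op) y = _
    rw [Scheme.Hom.appLE_map, Scheme.Hom.app_eq_appLE]
  rw [h0_eq]
  refine length_eq_of_ringEquiv (e0.trans θ) fun s => ?_
  rw [algebraMap_sections_eq₂ π (W : X.Opens) J.subschemeι hO]
  change θ (e0 _) = _
  rw [he0, hθ]
  rfl

end Centre

end Summit.ResolutionOfSingularities.ResolutionOfSingularities.Theorems.NoZeno.ExcCount.PointBlowup

end
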